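import Mathlib
import HarnessLib
import Summits.Ventures.LatticeQCDFlow.Exactness.NCMCGeneralSpacePairFunctionalCLT
import Summits.Ventures.LatticeQCDFlow.Exactness.NCMCGeneralSpaceConditionalMeanCLT

/-!
# The CLT for TRANSITION RATES out of an event: `√n (Σ 1_B(X_t) w(X_t,X_{t+1}) / Σ 1_B(X_t) − q_B) ⇒ N(0, V/π(B)²)` under a Doeblin power, from every initial law

HONEST FRAMING: exact (Metropolis-corrected) sampling algorithms for lattice gauge theory;
figures of merit are autocorrelation/cost numbers at stated couplings and volumes; no
continuum-physics claim.

Venture `LatticeQCDFlow` (cell pub-lqcd), topic `Exactness`; FANOUT row 13 (`eng-snf`, GEN-19).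
NEW WORK of the cell, not a published result; no definition is introduced; nothing is cited as a
fact.  The engine's ACCEPTANCE RATES (`acc_fwd` = number of prior→target transitions / number of
visits to the prior level; GEN-18 `NCMCGeneralSpaceOccupancyChainRatesEveryStart`: almost sure
convergence from every start) and rows 8/9's empirical tunnelling RATES are RATIOS of a two-time
average `Σ 1_B(X_t) w(X_t, X_{t+1})` to an occupancy count `Σ 1_B(X_t)`.  This file is the joint
(ratio) step: with `q_B = (∫ 1_B κw dπ)/π(B)` (the conditional transition rate), the centred pair
functional `φ(u, y) = 1_B(u)(w(u, y) − q_B)` has `∫∫ φ dκ dπ = 0`, so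
`√n (R_n − q_B) = [(√n)⁻¹ Σ φ(X_t, X_{t+1})] / p̂_B,n` whenever `B` has been visited; the two-time CLT
(`NCMCGeneralSpacePairFunctionalCLT`) for the numerator, the every-start LLN `p̂_B,n → π(B) > 0` and
Slutsky give the limit, and the no-visit event is almost surely eventually empty (as in
`NCMCGeneralSpaceConditionalMeanCLT`).

## Content (`κ` Markov on `S`, `π` invariant, `(nHit κ m)(z,·) ≥ ε ν` (`ε ≠ 0`, `0 < m`); `B`
## measurable, `π(B) > 0`; `w : S × S → ℝ` measurable, `|w| ≤ C`; `q_B = (∫ 1_B(u)(∫ w(u,y)κ(u,dy)) dπ)/π(B)`;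
## `φ(u,y) = 1_B(u)(w(u,y) − q_B)`; `h` bounded measurable with `h − κh = κφ`; `ψ = φ + h∘snd`,
## `V = ∫∫ (ψ − κψ)² dκ dπ`)

* `integral_kop_transitionCentred_eq_zero` — `∫ (∫ φ(u,y) κ(u,dy)) dπ = 0`.
* **`tendstoInDistribution_transitionRate_of_nHit`** — THE THEOREM: for EVERY initial law `μ₀`
  and every `Y ~ N(0, V/π(B)²)`:
  `TendstoInDistribution (fun n x => √n (Σ_{t<n} 1_B(x_t) w(x_t,x_{t+1}) / Σ_{t<n} 1_B(x_t) − q_B)) atTop Y (fun _ => P_{μ₀}) P'`.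

NOT CLAIMED: the Green–Kubo form of `V`; a plug-in variance; rates; the NCMC instance with GEN-18's
closed form of the limiting acceptance rate (the theorem applies verbatim with `B` = prior level,
`w` = indicator of the target level).
-/

namespace Summit.Ventures.LatticeQCDFlow.Exactness.GeneralNCMC

open MeasureTheory ProbabilityTheory Set Filter Finset Preorder
open scoped ENNReal Topology

variable {S : Type*} [MeasurableSpace S]

section Rate

variable {κ : Kernel S S} [IsMarkovKernel κ] {π : Measure S} [IsProbabilityMeasure π]
  {ν : Measure S} [IsProbabilityMeasure ν] {ε : ℝ≥0∞} {m : ℕ}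

omit [IsProbabilityMeasure π] in
/-- The transition-centred pair functional `φ(u,y) = 1_B(u)(w(u,y) − q_B)` has
`∫ (∫ φ(u,y) κ(u,dy)) dπ = 0` (`π` finite, `π(B) > 0`). -/
theorem integral_kop_transitionCentred_eq_zero [IsFiniteMeasure π] {B : Set S}
    (hB : MeasurableSet B) (hB0 : 0 < π.real B) {w : S × S → ℝ} (hw : Measurable w) {C : ℝ}
    (hC : ∀ p, |w p| ≤ C) :
    ∫ u, (∫ y, B.indicator (1 : S → ℝ) u * (w (u, y)
        - (∫ u', B.indicator (1 : S → ℝ) u' * (∫ y', w (u', y') ∂(κ u')) ∂π) / π.real B) ∂(κ u)) ∂π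
      = 0 := by
  set q : ℝ := (∫ u', B.indicator (1 : S → ℝ) u' * (∫ y', w (u', y') ∂(κ u')) ∂π) / π.real B with hq
  have hKm := measurable_kopPair κ hw
  have hKb : ∀ u, |∫ y, w (u, y) ∂(κ u)| ≤ C := abs_kopPair_le κ hC
  have hinner : ∀ u, ∫ y, B.indicator (1 : S → ℝ) u * (w (u, y) - q) ∂(κ u)
      = B.indicator (1 : S → ℝ) u * ((∫ y, w (u, y) ∂(κ u)) - q) := by
    intro u
    rw [integral_const_mul, integral_sub (Scoring.integrable_of_bounded _
      (show Measurable fun y => w (u, y) from hw.comp measurable_prodMk_left) (fun y => hC (u, y)))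
      (integrable_const _), integral_const, probReal_univ, one_smul]
  simp_rw [hinner, mul_sub]
  have hi1 : Integrable (fun u => B.indicator (1 : S → ℝ) u * ∫ y, w (u, y) ∂(κ u)) π :=
    Scoring.integrable_of_bounded π ((measurable_one.indicator hB).mul hKm) (C := 1 * C) fun u => by
      rw [abs_mul]
      refine mul_le_mul ?_ (hKb u) (abs_nonneg _) zero_le_one
      by_cases hu : u ∈ B <;> simp [hu]
  have hi2 : Integrable (fun u => B.indicator (1 : S → ℝ) u * q) π :=
    ((integrable_const (1 : ℝ)).indicator hB).mul_const q
  rw [integral_sub hi1 hi2, integral_mul_const, integral_indicator_one hB, hq,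
    mul_div_cancel₀ _ hB0.ne', sub_self]

/-- **THE TRANSITION-RATE CLT UNDER A DOEBLIN POWER, FROM ANY INITIAL LAW.**  With
`R_n = Σ_{t<n} 1_B(x_t) w(x_t, x_{t+1}) / Σ_{t<n} 1_B(x_t)`, `q_B = (∫ 1_B κw dπ)/π(B)`,
`φ = 1_B ⊗ (w − q_B)`, `h` a bounded Poisson solution `h − κh = κφ`, `ψ = φ + h∘snd`,
`V = ∫∫ (ψ − κψ)² dκ dπ`: for every initial law `μ₀` and every `Y ~ N(0, V/π(B)²)`,
`TendstoInDistribution (fun n x => √n (R_n(x) − q_B)) atTop Y (fun _ => P_{μ₀}) P'`. -/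
theorem tendstoInDistribution_transitionRate_of_nHit (hπ : Kernel.Invariant κ π) (hε : ε ≠ 0)
    (hmin : ∀ z, ε • ν ≤ nHit κ m z)
    {B : Set S} (hB : MeasurableSet B) (hB0 : 0 < π.real B)
    {w : S × S → ℝ} (hw : Measurable w) {C : ℝ} (hC : ∀ p, |w p| ≤ C)
    {h : S → ℝ} (hh : Measurable h) {Ch : ℝ} (hCh : ∀ x, |h x| ≤ Ch)
    (hpois : ∀ u, h u - Scoring.kop κ h u
      = (∫ y, B.indicator (1 : S → ℝ) u * (w (u, y)
          - (∫ u', B.indicator (1 : S → ℝ) u' * (∫ y', w (u', y') ∂(κ u')) ∂π) / π.real B) ∂(κ u))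
        - ∫ u'', (∫ y, B.indicator (1 : S → ℝ) u'' * (w (u'', y)
          - (∫ u', B.indicator (1 : S → ℝ) u' * (∫ y', w (u', y') ∂(κ u')) ∂π) / π.real B)
            ∂(κ u'')) ∂π)
    (μ₀ : Measure S) [IsProbabilityMeasure μ₀]
    {Ω' : Type*} [MeasurableSpace Ω'] {P' : Measure Ω'} [IsProbabilityMeasure P'] {Y : Ω' → ℝ}
    (hY : HasLaw Y (gaussianReal 0 (Real.toNNReal (
      (∫ u, (∫ y, ((B.indicator (1 : S → ℝ) u * (w (u, y)
          - (∫ u', B.indicator (1 : S → ℝ) u' * (∫ y', w (u', y') ∂(κ u')) ∂π) / π.real B) + h y)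
        - ∫ y', ((B.indicator (1 : S → ℝ) u * (w (u, y')
          - (∫ u', B.indicator (1 : S → ℝ) u' * (∫ y', w (u', y') ∂(κ u')) ∂π) / π.real B) + h y'))
          ∂(κ u)) ^ 2 ∂(κ u)) ∂π)
      / π.real B ^ 2))) P')
    [IsProbabilityMeasure (Kernel.trajMeasure (X := fun _ : ℕ => S) μ₀
        (fun n : ℕ => κ.comap (fun hh : (i : ↥(Finset.Iic n)) → S => hh ⟨n, Finset.mem_Iic.2 le_rfl⟩)
          (measurable_pi_apply _)))] :
    TendstoInDistribution (fun (n : ℕ) (x : ℕ → S) =>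
        Real.sqrt n * ((∑ t ∈ range n, B.indicator (1 : S → ℝ) (x t) * w (x t, x (t + 1))) /
          (∑ t ∈ range n, B.indicator (1 : S → ℝ) (x t))
          - (∫ u', B.indicator (1 : S → ℝ) u' * (∫ y', w (u', y') ∂(κ u')) ∂π) / π.real B))
      atTop Y (fun _ => Kernel.trajMeasure (X := fun _ : ℕ => S) μ₀
        (fun n : ℕ => κ.comap (fun hh : (i : ↥(Finset.Iic n)) → S => hh ⟨n, Finset.mem_Iic.2 le_rfl⟩)
          (measurable_pi_apply _))) P' := by
  -- notation
  set q : ℝ := (∫ u', B.indicator (1 : S → ℝ) u' * (∫ y', w (u', y') ∂(κ u')) ∂π) / π.real B with hq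
  set φ : S × S → ℝ := fun p => B.indicator (1 : S → ℝ) p.1 * (w p - q) with hφ
  set V : ℝ := ∫ u, (∫ y, ((φ (u, y) + h y) - ∫ y', (φ (u, y') + h y') ∂(κ u)) ^ 2 ∂(κ u)) ∂π
    with hV
  have hp0 : π.real B ≠ 0 := hB0.ne'
  have h1m : Measurable (B.indicator (1 : S → ℝ)) := measurable_one.indicator hB
  have hφm : Measurable φ := (h1m.comp measurable_fst).mul (hw.sub measurable_const)
  have hφC : ∀ p, |φ p| ≤ C + |q| := fun p => by
    rw [hφ]
    dsimp only
    rw [abs_mul]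
    have h1 : |B.indicator (1 : S → ℝ) p.1| ≤ 1 := by by_cases hu : p.1 ∈ B <;> simp [hu]
    calc |B.indicator (1 : S → ℝ) p.1| * |w p - q| ≤ 1 * (C + |q|) :=
          mul_le_mul h1 ((abs_sub _ _).trans (add_le_add (hC p) le_rfl)) (abs_nonneg _) zero_le_one
      _ = C + |q| := one_mul _
  have hm0 : ∫ u'', (∫ y, φ (u'', y) ∂(κ u'')) ∂π = 0 :=
    integral_kop_transitionCentred_eq_zero (κ := κ) hB hB0 hw hC
  -- the numerator CLT for the limit variable `π(B) · Y ~ N(0, V)`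
  have hYX : HasLaw (fun ω => π.real B * Y ω) (gaussianReal 0 (Real.toNNReal V)) P' := by
    have h0 := gaussianReal_const_mul hY (π.real B)
    rw [mul_zero] at h0
    have hnn : NNReal.mk (π.real B ^ 2) (sq_nonneg _) * (V / π.real B ^ 2).toNNReal = V.toNNReal := by
      rw [show V = π.real B ^ 2 * (V / π.real B ^ 2) by field_simp, Real.toNNReal_mul (sq_nonneg _)]
      rw [show π.real B ^ 2 * (V / π.real B ^ 2) = V by field_simp]
      congr 1
      apply NNReal.eq
      rw [NNReal.coe_mk, Real.coe_toNNReal _ (sq_nonneg _)]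
    rw [hnn] at h0
    exact h0
  have hX := tendstoInDistribution_pairTimeAverage_of_nHit hπ hε hmin hφm hφC hh hCh hpois μ₀ hYX
  simp_rw [hm0, sub_zero] at hX
  -- the denominator: `(p̂_B,n)⁻¹ → π(B)⁻¹` almost surely
  have hphat := tendsto_sum_div_anyLaw_of_nHit_minorised hπ hε hmin h1m
    ((integrable_const (1 : ℝ)).indicator hB) μ₀
  rw [integral_indicator_one hB] at hphat
  have hBm : ∀ n : ℕ, Measurable fun x : ℕ → S =>
      ((∑ t ∈ range n, B.indicator (1 : S → ℝ) (x t)) / n)⁻¹ := fun n =>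
    ((Finset.measurable_sum _ fun t _ => h1m.comp (measurable_pi_apply t)).div_const _).inv
  have hBconv : TendstoInMeasure (Kernel.trajMeasure (X := fun _ : ℕ => S) μ₀
      (fun n : ℕ => κ.comap (fun hh : (i : ↥(Finset.Iic n)) → S => hh ⟨n, Finset.mem_Iic.2 le_rfl⟩)
        (measurable_pi_apply _))) (fun (n : ℕ) (x : ℕ → S) =>
      ((∑ t ∈ range n, B.indicator (1 : S → ℝ) (x t)) / n)⁻¹) atTop (fun _ => (π.real B)⁻¹) := by
    refine tendstoInMeasure_of_tendsto_ae (fun n => (hBm n).aestronglyMeasurable) ?_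
    filter_upwards [hphat] with x hx
    exact hx.inv₀ hp0
  -- Slutsky
  have hXB := hX.continuous_comp_prodMk_of_tendstoInMeasure_const
    (g := fun p : ℝ × ℝ => p.1 * p.2) (by fun_prop) hBconv (fun n => (hBm n).aemeasurable)
  have hlim : (fun ω' => (fun p : ℝ × ℝ => p.1 * p.2) (π.real B * Y ω', (π.real B)⁻¹)) = Y := by
    funext ω'
    dsimp only
    rw [mul_comm (π.real B) (Y ω'), mul_assoc, mul_inv_cancel₀ hp0, mul_one]
  rw [hlim] at hXB
  -- the ratio statistic agrees with the Slutsky product as soon as `B` has been visited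
  have hRm : ∀ n : ℕ, Measurable fun x : ℕ → S =>
      Real.sqrt n * ((∑ t ∈ range n, B.indicator (1 : S → ℝ) (x t) * w (x t, x (t + 1))) /
        (∑ t ∈ range n, B.indicator (1 : S → ℝ) (x t)) - q) := fun n =>
    measurable_const.mul (((Finset.measurable_sum _ fun t _ =>
      (h1m.comp (measurable_pi_apply t)).mul
        (hw.comp ((measurable_pi_apply t).prodMk (measurable_pi_apply (t + 1))))).div
      (Finset.measurable_sum _ fun t _ => h1m.comp (measurable_pi_apply t))).sub measurable_const)
  refine tendstoInDistribution_of_tendstoInMeasure_sub _ Y hXB ?_ (fun n => (hRm n).aemeasurable)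
  have hXm : ∀ n : ℕ, Measurable fun x : ℕ → S =>
      (Real.sqrt n)⁻¹ * ∑ t ∈ range n, φ (x t, x (t + 1)) := fun n =>
    measurable_const.mul (Finset.measurable_sum _ fun t _ =>
      hφm.comp ((measurable_pi_apply t).prodMk (measurable_pi_apply (t + 1))))
  refine tendstoInMeasure_of_tendsto_ae
    (fun n => ((hRm n).sub ((hXm n).mul (hBm n))).aestronglyMeasurable) ?_
  filter_upwards [hphat] with x hx
  have hev : ∀ᶠ n : ℕ in atTop, π.real B / 2 < (∑ t ∈ range n, B.indicator (1 : S → ℝ) (x t)) / n :=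
    hx.eventually (lt_mem_nhds (by linarith))
  refine (tendsto_const_nhds (x := (0 : ℝ))).congr' ?_
  filter_upwards [hev, eventually_ge_atTop 1] with n hn hn1
  have hnpos : (0 : ℝ) < n := by exact_mod_cast hn1
  have hTpos : 0 < ∑ t ∈ range n, B.indicator (1 : S → ℝ) (x t) := by
    have h2 : 0 < (∑ t ∈ range n, B.indicator (1 : S → ℝ) (x t)) / n := by linarith
    exact (div_pos_iff_of_pos_right hnpos).1 h2
  have hsum : ∑ t ∈ range n, φ (x t, x (t + 1))
      = ∑ t ∈ range n, B.indicator (1 : S → ℝ) (x t) * w (x t, x (t + 1))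
        - q * ∑ t ∈ range n, B.indicator (1 : S → ℝ) (x t) := by
    rw [Finset.mul_sum, ← Finset.sum_sub_distrib]
    refine Finset.sum_congr rfl fun t _ => ?_
    rw [hφ]
    dsimp only
    ring
  simp only [Pi.sub_apply]
  rw [hsum, ← ratio_identity (Real.mul_self_sqrt hnpos.le) (Real.sqrt_pos.2 hnpos).ne' hTpos.ne',
    sub_self]

end Rate

end Summit.Ventures.LatticeQCDFlow.Exactness.GeneralNCMC
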